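import Literature.NumberTheory.EllipticCurves.HeegnerGeomTransversalProofs
import HarnessLib

/-!
# A `p`-step of the ring class tower acts on points of the lower field as multiplication by `p`
# (Gross 1991 §3 / Perrin-Riou 1987 §3.3: `[K[pm] : K[m]] = p` for `p ∣ m`, read on `E(K̄)`)

Topic `NumberTheory/EllipticCurves` (complex multiplication / Heegner points). THEOREMS ONLY (no definition,
no named fact; net Literature debt `0`). Cell `bsd-print-x9`, seat x9-p1 (LEAD; envelope infrastructure part IV-a
for the cruxes stmt-BirchSwinnertonDyer-25235 / -26359). For `p ∣ m` (`m ≠ 0`) a transversal of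
`Gal(K̄/K[pm])` in `Gal(K̄/K[m])` has exactly `p = [K[pm] : K[m]]` elements (`card_ringClassGalOver_eq_of_dvd`,
lifted to `Γ_K` by the dictionary of `HeegnerGeomGaloisTransferProofs`), so for a point `x ∈ E(K̄)` fixed by
`Gal(K̄/K[m])` every such transversal sum is `p • x` (`sum_transversal_smul_eq_prime_smul`) — the coefficient `p`
in the recurrence `S_{j+1} = a_p S_j − p S_{j-1}` of the Heegner norms along the anticyclotomic layers
(Perrin-Riou §3.3, Howard §3.3). HONEST FRAMING: Galois bookkeeping; nothing on `L`-functions, Selmer groups or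
BSD is asserted. References: [GrossLMS1991] §3; [PerrinRiou1987BSMF] §3.3; [Cox2013] §7.D Cor. 7.28.
-/

set_option autoImplicit false

noncomputable section

open scoped Classical

namespace Literature.NumberTheory.EllipticCurves

open WeierstrassCurve RingClassField

variable {K : Type} [Field K] [NumberField K]

/-- **A transversal of `Gal(K̄/K[pm])` in `Gal(K̄/K[m])` with exactly `p` elements** (`p` prime, `p ∣ m`,
`m ≠ 0`): lift each element of `Gal(K[pm]/K[m])` (a group of order `p`, `card_ringClassGalOver_eq_of_dvd`) to
`Gal(K̄/K[m])` (`exists_mem_ringClassSubgroup_induces_of_mem_ringClassGalOver`).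
[cite: Cox2013, §7.D Cor. 7.28 ([K[pm] : K[m]] for p ∣ m)] [cite: GrossLMS1991, §3 (#G_ℓ)] -/
theorem exists_transversal_ringClassSubgroup_card_eq (hK : IsImaginaryQuadratic K)
    (jbar : AlgebraicClosure K →+* ℂ) {p m : ℕ} (hp : p.Prime) (hpm : p ∣ m) (hm : m ≠ 0) :
    ∃ S : Finset (Field.absoluteGaloisGroup K), (∀ s ∈ S, s ∈ ringClassSubgroup K m jbar) ∧
      (∀ τ ∈ ringClassSubgroup K m jbar, ∃! s, s ∈ S ∧ s⁻¹ * τ ∈ ringClassSubgroup K (p * m) jbar) ∧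
      S.card = p := by
  have hpm0 : p * m ≠ 0 := mul_ne_zero hp.ne_zero hm
  have hdvd : m ∣ p * m := Dvd.intro_left p rfl
  set ι : K →+* ℂ := jbar.comp (algebraMap K (AlgebraicClosure K)) with hι
  -- lifts of the elements of `Gal(K[pm]/K[m])`, and automorphisms of `ℂ` inducing them
  choose τ hτ τC hτC hτg using fun (g : ringClassField K ι (p * m) ≃ₐ[ℚ] ringClassField K ι (p * m))
    (hg : g ∈ ringClassGalOver ι (p * m) m) ↦
      exists_mem_ringClassSubgroup_induces_of_mem_ringClassGalOver hK jbar hdvd hpm0 hg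
  let τ' : (ringClassField K ι (p * m) ≃ₐ[ℚ] ringClassField K ι (p * m)) → Field.absoluteGaloisGroup K :=
    fun g ↦ if hg : g ∈ ringClassGalOver ι (p * m) m then τ g hg else 1
  have hτ' : ∀ g (hg : g ∈ ringClassGalOver ι (p * m) m), τ' g = τ g hg := fun g hg ↦ dif_pos hg
  -- an element of `Γ_K` inducing `g` on `K[pm]` determines `g`
  have hdet : ∀ (g : ringClassField K ι (p * m) ≃ₐ[ℚ] ringClassField K ι (p * m))
      (σ : Field.absoluteGaloisGroup K) (σC : ℂ ≃+* ℂ), (∀ a, σC (jbar a) = jbar (σ • a)) →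
      (∀ x : ringClassField K ι (p * m), σC x = ((g x : ringClassField K ι (p * m)) : ℂ)) →
      ∀ (g' : ringClassField K ι (p * m) ≃ₐ[ℚ] ringClassField K ι (p * m)) (σC' : ℂ ≃+* ℂ),
      (∀ a, σC' (jbar a) = jbar (σ • a)) →
      (∀ x : ringClassField K ι (p * m), σC' x = ((g' x : ringClassField K ι (p * m)) : ℂ)) → g = g' := by
    intro g σ σC hσC hg g' σC' hσC' hg'
    apply AlgEquiv.ext; intro x; apply Subtype.ext
    obtain ⟨a, ha⟩ := mem_range_of_mem_ringClassField hK jbar hpm0 x.2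
    rw [← hg x, ← hg' x, ← ha, hσC, hσC']
  haveI := (finiteDimensional_and_isGalois_ringClassField hK ι hpm0).1
  haveI : FiniteDimensional ℚ (ringClassField K ι (p * m)) := Module.Finite.trans K (ringClassField K ι (p * m))
  have hfin : (ringClassGalOver ι (p * m) m :
      Set (ringClassField K ι (p * m) ≃ₐ[ℚ] ringClassField K ι (p * m))).Finite := Set.toFinite _
  refine ⟨hfin.toFinset.image τ', fun s hs ↦ ?_, fun σ hσ ↦ ?_, ?_⟩
  · obtain ⟨g, hg, rfl⟩ := Finset.mem_image.mp hs
    have hg' := (hfin.mem_toFinset).mp hg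
    rw [hτ' g hg']; exact hτ g hg'
  · -- restrict `σ` to `K[pm]`; it lands in `Gal(K[pm]/K[m])`
    obtain ⟨σC, hσC, g, -, hgσ⟩ :=
      exists_ringEquiv_exists_mem_ringClassGal_of_absoluteGaloisGroup hK jbar hpm0 σ
    have hgOver : g ∈ ringClassGalOver ι (p * m) m := by
      rw [ringClassGalOver, mem_fixingSubgroup_iff]
      rintro y (hy : (y : ℂ) ∈ ringClassField K ι m)
      apply Subtype.ext
      show ((g y : ringClassField K ι (p * m)) : ℂ) = y
      rw [hgσ y]
      exact ringEquiv_apply_eq_self_of_mem_ringClassSubgroup hK hm hσ hσC hy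
    have key : ∀ s, s⁻¹ * σ ∈ ringClassSubgroup K (p * m) jbar ↔
        ∃ sC : ℂ ≃+* ℂ, (∀ a, sC (jbar a) = jbar (s • a)) ∧
          ∀ x : ringClassField K ι (p * m), sC x = ((g x : ringClassField K ι (p * m)) : ℂ) := by
      intro s
      constructor
      · intro hs
        obtain ⟨sC, hsC⟩ := exists_ringEquiv_apply_eq_smul jbar s
        refine ⟨sC, hsC, fun x ↦ ?_⟩
        obtain ⟨a, ha⟩ := mem_range_of_mem_ringClassField hK jbar hpm0 x.2
        rw [hgσ x, ← ha, hsC, hσC]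
        congr 1
        have h1 : (s⁻¹ * σ) • a = a := smul_eq_self_of_mem_ringClassSubgroup hK jbar hpm0 hs (by rw [ha]; exact x.2)
        calc s • a = s • ((s⁻¹ * σ) • a) := by rw [h1]
          _ = σ • a := by rw [← mul_smul, mul_inv_cancel_left]
      · rintro ⟨sC, hsC, hsg⟩
        refine mem_ringClassSubgroup_of_ringEquiv_apply_eq_self (σC := σC.trans sC.symm) ?_ ?_
        · intro a
          rw [RingEquiv.trans_apply, RingEquiv.symm_apply_eq, hσC, hsC, mul_smul, smul_inv_smul]
        · intro u hu
          rw [RingEquiv.trans_apply, RingEquiv.symm_apply_eq]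
          have e1 : σC u = ((g ⟨u, hu⟩ : ringClassField K ι (p * m)) : ℂ) := (hgσ ⟨u, hu⟩).symm
          have e2 : sC u = ((g ⟨u, hu⟩ : ringClassField K ι (p * m)) : ℂ) := hsg ⟨u, hu⟩
          rw [e1, e2]
    refine ⟨τ' g, ⟨Finset.mem_image.mpr ⟨g, hfin.mem_toFinset.mpr hgOver, rfl⟩, ?_⟩, ?_⟩
    · rw [hτ' g hgOver, key]
      exact ⟨τC g hgOver, hτC g hgOver, hτg g hgOver⟩
    · rintro s ⟨hs, hsσ⟩
      obtain ⟨g', hg', rfl⟩ := Finset.mem_image.mp hs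
      have hg'Over := (hfin.mem_toFinset).mp hg'
      obtain ⟨sC, hsC, hsg⟩ := (key _).mp hsσ
      have hgg' : g' = g := hdet g' (τ' g') (τC g' hg'Over) (by rw [hτ' g' hg'Over]; exact hτC g' hg'Over)
        (hτg g' hg'Over) g sC hsC hsg
      rw [hgg']
  · -- the count: `τ'` is injective on `Gal(K[pm]/K[m])`, which has `p` elements
    rw [Finset.card_image_of_injOn, ← Set.ncard_eq_toFinset_card _ hfin, ← Nat.card_coe_set_eq]
    · exact HeegnerTraceDividing.card_ringClassGalOver_eq_of_dvd hK ι hp hpm hm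
    · intro g₁ hg₁ g₂ hg₂ h
      rw [Finset.mem_coe, Set.Finite.mem_toFinset] at hg₁ hg₂
      have h' : τ g₁ hg₁ = τ g₂ hg₂ := by rw [← hτ' g₁ hg₁, ← hτ' g₂ hg₂]; exact h
      exact hdet g₁ (τ g₁ hg₁) (τC g₁ hg₁) (hτC g₁ hg₁) (hτg g₁ hg₁) g₂ (τC g₂ hg₂)
        (by rw [h']; exact hτC g₂ hg₂) (hτg g₂ hg₂)

/-- **A `p`-step of the tower multiplies lower points by `p`**: for `p` prime, `p ∣ m`, `m ≠ 0`, a point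
`x ∈ E(K̄)` fixed by `Gal(K̄/K[m])` and ANY finite transversal `S` of `Gal(K̄/K[pm])` in `Gal(K̄/K[m])`:
`∑_{s ∈ S} s • x = p • x` — print's `Norm_{K[pm]/K[m]} y = [K[pm] : K[m]] y = p·y` for `y ∈ E(K[m])`.
[cite: PerrinRiou1987BSMF, §3.3 (relations de distribution, the factor [H_{cp}:H_c])] [cite: GrossLMS1991, §3] -/
theorem sum_transversal_smul_eq_prime_smul (hK : IsImaginaryQuadratic K) (jbar : AlgebraicClosure K →+* ℂ)
    {p m : ℕ} (hp : p.Prime) (hpm : p ∣ m) (hm : m ≠ 0) {V : WeierstrassCurve K}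
    {x : WeierstrassCurve.geomPoints V} (hx : ∀ σ ∈ ringClassSubgroup K m jbar, σ • x = x)
    {S : Finset (Field.absoluteGaloisGroup K)} (hS : ∀ s ∈ S, s ∈ ringClassSubgroup K m jbar)
    (htS : ∀ τ ∈ ringClassSubgroup K m jbar, ∃! s, s ∈ S ∧ s⁻¹ * τ ∈ ringClassSubgroup K (p * m) jbar) :
    ∑ s ∈ S, s • x = (p : ℤ) • x := by
  obtain ⟨S₀, hS₀, htS₀, hcard⟩ := exists_transversal_ringClassSubgroup_card_eq hK jbar hp hpm hm
  have hx' : ∀ σ ∈ ringClassSubgroup K (p * m) jbar, σ • x = x := fun σ hσ ↦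
    hx σ (ringClassSubgroup_anti hK jbar (Dvd.intro_left p rfl) (mul_ne_zero hp.ne_zero hm) hσ)
  rw [sum_smul_eq_of_transversal hS hS₀ htS htS₀ hx',
    Finset.sum_congr rfl fun s hs ↦ hx s (hS₀ s hs), Finset.sum_const, hcard, natCast_zsmul]

/-- **The two-term recurrence of the Heegner norms along a layer** (Perrin-Riou 1987 §3.3 / Howard 2004 §3.3:
`S_{e+2} = a_p S_{e+1} − p S_e` for the norms `S_j = Norm_{K[p^j]/L} P[p^j]` to a field `L ⊆ K[p^e]`, `e ≥ 1`):
for `E = W/ℚ` at level `N_E`, `K` Heegner, orientation `β`, good `p`, the principal points `x₀, x₁, x₂` of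
conductors `p^e, p^{e+1}, p^{e+2}` (`e ≥ 1`), a subgroup `Λ ≥ Gal(K̄/K[p^e])` and finite transversals `A₀, A₁, R ⊆ Λ`
of `Gal(K̄/K[p^e])`, `Gal(K̄/K[p^{e+1}])`, `Gal(K̄/K[p^{e+2}])` in `Λ`:
`∑_{r ∈ R} r • x₂ = a_p • ∑_{a ∈ A₁} a • x₁ − p • ∑_{a ∈ A₀} a • x₀`.
[cite: PerrinRiou1987BSMF, §3.3 (relations de distribution)] [cite: Howard2004HeegnerKolyvagin, §3.3] [cite: Darmon2004, Prop. 3.10 (case ℓ ∣ n)] -/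
theorem sum_transversal_smul_eq_frobeniusTrace_smul_sub_prime_smul {W : WeierstrassCurve ℚ} [W.IsElliptic]
    [W.IsGloballyMinimal] [NeZero (W.conductorNorm ℤ)] (hK : IsImaginaryQuadratic K)
    (hH : SatisfiesHeegnerHypothesis (W.conductorNorm ℤ) K)
    (Dt : ModularForms.ModularParametrizationData W (W.conductorNorm ℤ)) {β : ℤ}
    (hβ : (4 * (W.conductorNorm ℤ : ℕ) : ℤ) ∣ β ^ 2 - NumberField.discr K)
    (jbar : AlgebraicClosure K →+* ℂ) {p : ℕ} (hp : p.Prime) (hpN : ¬ p ∣ W.conductorNorm ℤ) {e : ℕ}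
    (he : 1 ≤ e) {x₀ x₁ x₂ : WeierstrassCurve.geomPoints (W.baseChange K)}
    (hx₀ : complexPoint W jbar x₀ =
      ModularForms.heegnerPointComplexOfConductor Dt (NumberField.discr K) β (p ^ e))
    (hx₀fix : ∀ σ ∈ ringClassSubgroup K (p ^ e) jbar, σ • x₀ = x₀)
    (hx₁ : complexPoint W jbar x₁ =
      ModularForms.heegnerPointComplexOfConductor Dt (NumberField.discr K) β (p ^ (e + 1)))
    {P₂ : (W.baseChange (ringClassField K (jbar.comp (algebraMap K (AlgebraicClosure K))) (p ^ (e + 2)))).toAffine.Point}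
    (hx₂ : complexPoint W jbar x₂ = WeierstrassCurve.Affine.Point.map (W' := W)
      (ringClassField K (jbar.comp (algebraMap K (AlgebraicClosure K))) (p ^ (e + 2))).subtype.toRatAlgHom P₂)
    (hP₂ : WeierstrassCurve.Affine.Point.map (W' := W)
      (ringClassField K (jbar.comp (algebraMap K (AlgebraicClosure K))) (p ^ (e + 2))).subtype.toRatAlgHom P₂ =
      ModularForms.heegnerPointComplexOfConductor Dt (NumberField.discr K) β (p ^ (e + 2)))
    (hx₂fix : ∀ σ ∈ ringClassSubgroup K (p ^ (e + 2)) jbar, σ • x₂ = x₂)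
    {Λ : Subgroup (Field.absoluteGaloisGroup K)} (hΛ : ringClassSubgroup K (p ^ e) jbar ≤ Λ)
    {A₀ : Finset (Field.absoluteGaloisGroup K)} (hA₀ : ∀ a ∈ A₀, a ∈ Λ)
    (htA₀ : ∀ τ ∈ Λ, ∃! a, a ∈ A₀ ∧ a⁻¹ * τ ∈ ringClassSubgroup K (p ^ e) jbar)
    {A₁ : Finset (Field.absoluteGaloisGroup K)} (hA₁ : ∀ a ∈ A₁, a ∈ Λ)
    (htA₁ : ∀ τ ∈ Λ, ∃! a, a ∈ A₁ ∧ a⁻¹ * τ ∈ ringClassSubgroup K (p ^ (e + 1)) jbar)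
    {R : Finset (Field.absoluteGaloisGroup K)} (hR : ∀ r ∈ R, r ∈ Λ)
    (htR : ∀ τ ∈ Λ, ∃! r, r ∈ R ∧ r⁻¹ * τ ∈ ringClassSubgroup K (p ^ (e + 2)) jbar) :
    ∑ r ∈ R, r • x₂ = (W.frobeniusTrace p) • ∑ a ∈ A₁, a • x₁ - (p : ℤ) • ∑ a ∈ A₀, a • x₀ := by
  have he0 : p ^ e ≠ 0 := pow_ne_zero _ hp.ne_zero
  have hle₁ : ringClassSubgroup K (p ^ (e + 1)) jbar ≤ ringClassSubgroup K (p ^ e) jbar :=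
    ringClassSubgroup_anti hK jbar (pow_dvd_pow p (Nat.le_succ e)) (pow_ne_zero _ hp.ne_zero)
  -- one-step descent with the shared transversal `A₁`
  rw [sum_transversal_smul_eq_frobeniusTrace_smul_sub_of_le hK hH Dt hβ jbar hp hpN e hx₀ hx₁ hx₂ hP₂ hx₂fix
    (hle₁.trans hΛ) hA₁ htA₁ hR htR]
  congr 1
  -- `∑_{A₁} a • x₀ = p • ∑_{A₀} a • x₀`: decompose `A₁` through `Gal(K̄/K[p^e])`, whose `p`-element
  -- transversal of `Gal(K̄/K[p^{e+1}])` fixes `x₀`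
  have hpe : p ∣ p ^ e := dvd_pow_self p (by omega)
  have hpe' : p * p ^ e = p ^ (e + 1) := by rw [← pow_succ']
  obtain ⟨S, hS, htS, -⟩ := exists_transversal_ringClassSubgroup_card_eq hK jbar hp hpe he0
  rw [hpe'] at htS
  rw [sum_smul_eq_sum_sum_smul hle₁ hΛ hA₀ htA₀ hS htS hA₁ htA₁
    (fun σ hσ ↦ hx₀fix σ (hle₁ hσ)), Finset.smul_sum]
  refine Finset.sum_congr rfl fun a _ ↦ ?_
  rw [sum_transversal_smul_eq_prime_smul hK jbar hp hpe he0 hx₀fix hS (by rw [hpe']; exact htS)]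
  exact map_zsmul (DistribSMul.toAddMonoidHom _ a) (p : ℤ) x₀

end Literature.NumberTheory.EllipticCurves

end
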